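import Summits.Langlands.Langlands.Theses.ParityBlindBianchi
import Literature.NumberTheory.Automorphic.BaseChangeCyclicCuspidal
import Literature.NumberTheory.Automorphic.BaseChangeStrongUnramified
import Literature.NumberTheory.Automorphic.BaseChangeStrongAllFinite
import Literature.NumberTheory.Automorphic.BaseChangeArchimedean

/-!
# Crux-strategist r1 (REDIRECT lane) — position certificate for
# `ParityBlindBianchi.QuadraticBaseChangeGL2` (QBC, item stmt-Langlands-16812)

Unit `cstrat-stmt-Langlands-16812-r1` (planner-cstrat-stmt-Langlands-16812-r1-0), 2026-08-17.
Companion of `Cruxes/QuadraticBaseChangeGL2/STRATEGY-CENSUS.md` (strategist r1). Sorry-free.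

What is certified here, BY NAME against the live route file (rev 18):

* `crux_of_facts` : QBC is the `n = 2`, `[E:F] = 2` instance of the conjunction of FOUR NAMED
  LITERATURE FACTS of the tree, each the statement of a theorem in print —
  `baseChange_cyclic_cuspidal` (Arthur–Clozel 1989, Ch. 3 Thm 4.2 (a): cuspidal weak lift),
  `ArthurClozel1989_strongLifting_unramified` (Ch. 3 Thm 5.1 + Ch. 1 §6: unramified strong lift and
  descent of unramifiedness), `ArthurClozel1989_strongLifting_allFinite` (Thm 5.1 + Ch. 1 Prop. 6.7:
  the Hecke relation at every finite place), `ArthurClozel1989_strongLifting_archimedean` (Thm 5.1 +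
  Ch. 1 §7: archimedean parameters restrict); for `n = 2` all four are Langlands 1980 (Ann. of Math.
  Stud. 96).  `finrank F E = 2` supplies the prime degree and the cyclic Galois group.  So QBC is
  bounded above by theorems in print — it has no open content; in particular it is STRICTLY WEAKER
  than the summit `Langlands` (global reciprocity for every `GL_n`, open), which no cheap tactic and
  no landed theorem derives from it (probe files `bc/QBC_to_S_probe.lean`, `bc/CruxProbe.lean` P5).
* `closes_of_facts` : the route's deciding theorem with the QBC binder discharged by those facts —
  i.e. the only thing QBC adds to `closes` over the vendored facts is the harness ruling that XL-apex
  facts are not citable in closes-serving proofs, not mathematics.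
* `clauseC_of_allFinite`, `clauseB_of_unramified`, `clauseD_of_archimedean`, `clauseA_of_cuspidal` :
  the same instance clause by clause, so that a host proving any ONE all-`n` fact (e.g. the item
  `SkinnerWilesDefectOne.StrongLiftingAllFinite`, which is `Iff.rfl`-equal to the all-finite fact)
  discharges the matching conjunct of QBC by name.

Nothing here is new mathematics: the same instance is kernel-checked in the standing disprover's
`Cruxes/QuadraticBaseChangeGL2/Disproof.lean` (`quadraticBaseChangeGL2_of_facts`, §1) and was checked
by the grounder and the refuter; it is re-checked here against rev 18, in an importable namespace of
its own, so that the tribunal has one statement to cite.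
-/

noncomputable section

-- `Summit.Langlands.Langlands.…`: summit = sub-problem name (D-0017 nested layout), not a typo.
set_option linter.dupNamespace false

namespace Summit.Langlands.Langlands.Cruxes.QuadraticBaseChangeGL2.StrategistR1

open Summit.Langlands.Langlands.Theses.ParityBlindBianchi
open Literature.NumberTheory.Automorphic

/-- `[E : F] = 2` is a prime degree. [folklore] -/
theorem prime_finrank_of_eq_two {F E : Type*} [Field F] [Field E] [Algebra F E]
    (h2 : Module.finrank F E = 2) : (Module.finrank F E).Prime := by
  rw [h2]; exact Nat.prime_two

/-- A Galois extension of degree `2` has cyclic Galois group (order `2`). [folklore] -/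
theorem isCyclic_aut_of_finrank_eq_two {F E : Type*} [Field F] [Field E] [Algebra F E]
    [IsGalois F E] (h2 : Module.finrank F E = 2) : IsCyclic (E ≃ₐ[F] E) :=
  haveI : FiniteDimensional F E := Module.finite_of_finrank_eq_succ h2
  isCyclic_of_prime_card (p := Module.finrank F E) (hp := ⟨prime_finrank_of_eq_two h2⟩)
    (IsGalois.card_aut_eq_finrank F E)

/-- **Clause (a) ⟸ `baseChange_cyclic_cuspidal` at `n = 2`** (A–C Ch. 3 Thm 4.2 (a); Langlands 1980).
[cite: ArthurClozelAMS120, Ch. 3 Thm 4.2 (a)] -/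
theorem clauseA_of_cuspidal (ha : baseChange_cyclic_cuspidal) :
    ∀ (F E : Type) [Field F] [NumberField F] [Field E] [NumberField E] [Algebra F E] [IsGalois F E],
      Module.finrank F E = 2 →
      ∀ (hF : isCompact_glFiniteIntegralLevel 2 F) (π : CuspidalAutomorphicRepData 2 F hF),
        (∃ (v : IsDedekindDomain.HeightOneSpectrum (NumberField.RingOfIntegers F))
            (w : IsDedekindDomain.HeightOneSpectrum (NumberField.RingOfIntegers E)) (α : Multiset ℂ),
            w.asIdeal.under (NumberField.RingOfIntegers F) = v.asIdeal ∧
            w.asIdeal.inertiaDeg (NumberField.RingOfIntegers F) = Module.finrank F E ∧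
            π.1.HasSatakeParamAt v α ∧
            ∀ ζ : ℂ, IsPrimitiveRoot ζ (Module.finrank F E) → α.map (ζ * ·) ≠ α) →
        ∀ (hE : isCompact_glFiniteIntegralLevel 2 E),
          ∃ P : CuspidalAutomorphicRepData 2 E hE, IsWeakBaseChangeLiftAE π.1 P.1 := by
  intro F E _ _ _ _ _ _ h2 hF π hw hE
  exact ha 2 F E (prime_finrank_of_eq_two h2) hF π hw hE

/-- **QBC ⟸ the four vendored base-change facts at `n = 2`, `[E:F] = 2`.**  Clause by clause, with
`(Module.finrank F E).Prime` from `finrank = 2` and, for (d), cyclicity of the order-two Galois group.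
[cite: ArthurClozelAMS120, Ch. 3 Thm 4.2 (a), Thm 5.1] -/
theorem crux_of_facts (ha : baseChange_cyclic_cuspidal)
    (hb : ArthurClozel1989_strongLifting_unramified) (hc : ArthurClozel1989_strongLifting_allFinite)
    (hd : ArthurClozel1989_strongLifting_archimedean) : QuadraticBaseChangeGL2 := by
  refine ⟨?_, ?_, ?_, ?_⟩
  · intro F E _ _ _ _ _ _ h2 hF π hw hE
    exact ha 2 F E (prime_finrank_of_eq_two h2) hF π hw hE
  · intro F E _ _ _ _ _ _ h2 hF hE π P hlift
    exact hb 2 F E (prime_finrank_of_eq_two h2) hF hE π P hlift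
  · intro F E _ _ _ _ _ _ h2 hF hE π P hlift
    exact hc 2 F E (prime_finrank_of_eq_two h2) hF hE π P hlift
  · intro F E _ _ _ _ _ _ h2 hF hE π P hlift
    exact hd 2 F E hF hE (isCyclic_aut_of_finrank_eq_two h2) (prime_finrank_of_eq_two h2) π P hlift

/-- **QBC is definitionally the conjunction of its four clauses; projections.**  Clause (c) (the Hecke
relation at every finite place) from the all-finite fact alone. [cite: ArthurClozelAMS120, Ch. 3 Thm 5.1] -/
theorem clauseC_of_allFinite (hc : ArthurClozel1989_strongLifting_allFinite) :
    ∀ (F E : Type) [Field F] [NumberField F] [Field E] [NumberField E] [Algebra F E] [IsGalois F E],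
      Module.finrank F E = 2 →
      ∀ (hF : isCompact_glFiniteIntegralLevel 2 F) (hE : isCompact_glFiniteIntegralLevel 2 E)
        (π : CuspidalAutomorphicRepData 2 F hF) (P : CuspidalAutomorphicRepData 2 E hE),
        IsWeakBaseChangeLiftAE π.1 P.1 →
        ∀ (w : IsDedekindDomain.HeightOneSpectrum (NumberField.RingOfIntegers E))
          (v : IsDedekindDomain.HeightOneSpectrum (NumberField.RingOfIntegers F)) (α : Multiset ℂ),
          w.asIdeal.under (NumberField.RingOfIntegers F) = v.asIdeal → π.1.HasSatakeParamAt v α →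
          P.1.HasSatakeParamAt w (α.map (· ^ w.asIdeal.inertiaDeg (NumberField.RingOfIntegers F))) := by
  intro F E _ _ _ _ _ _ h2 hF hE π P hlift
  exact hc 2 F E (prime_finrank_of_eq_two h2) hF hE π P hlift

/-- Clause (b) (unramified strong lift + descent of unramifiedness) from the unramified fact alone.
[cite: ArthurClozelAMS120, Ch. 3 Thm 5.1] -/
theorem clauseB_of_unramified (hb : ArthurClozel1989_strongLifting_unramified) :
    ∀ (F E : Type) [Field F] [NumberField F] [Field E] [NumberField E] [Algebra F E] [IsGalois F E],
      Module.finrank F E = 2 →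
      ∀ (hF : isCompact_glFiniteIntegralLevel 2 F) (hE : isCompact_glFiniteIntegralLevel 2 E)
        (π : CuspidalAutomorphicRepData 2 F hF) (P : CuspidalAutomorphicRepData 2 E hE),
        IsWeakBaseChangeLiftAE π.1 P.1 →
        IsUnramifiedBaseChangeLift π.1 P.1 ∧
          ∀ v : IsDedekindDomain.HeightOneSpectrum (NumberField.RingOfIntegers F),
            Algebra.IsUnramifiedIn (NumberField.RingOfIntegers E) v.asIdeal →
            (∀ w : IsDedekindDomain.HeightOneSpectrum (NumberField.RingOfIntegers E),
              w.asIdeal.under (NumberField.RingOfIntegers F) = v.asIdeal → P.1.IsUnramifiedAt w) →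
            π.1.IsUnramifiedAt v := by
  intro F E _ _ _ _ _ _ h2 hF hE π P hlift
  exact hb 2 F E (prime_finrank_of_eq_two h2) hF hE π P hlift

/-- Clause (d) (archimedean parameters restrict) from the archimedean fact alone.
[cite: ArthurClozelAMS120, Ch. 3 Thm 5.1; Ch. 1 §7] -/
theorem clauseD_of_archimedean (hd : ArthurClozel1989_strongLifting_archimedean) :
    ∀ (F E : Type) [Field F] [NumberField F] [Field E] [NumberField E] [Algebra F E] [IsGalois F E],
      Module.finrank F E = 2 →
      ∀ (hF : isCompact_glFiniteIntegralLevel 2 F) (hE : isCompact_glFiniteIntegralLevel 2 E)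
        (π : CuspidalAutomorphicRepData 2 F hF) (P : CuspidalAutomorphicRepData 2 E hE),
        IsWeakBaseChangeLiftAE π.1 P.1 →
        ∀ χ : (F →+* ℂ) → Multiset ℂ, π.1.HasArchParameter χ →
          P.1.HasArchParameter fun τ => χ (τ.comp (algebraMap F E)) := by
  intro F E _ _ _ _ _ _ h2 hF hE π P hlift
  exact hd 2 F E hF hE (isCyclic_aut_of_finrank_eq_two h2) (prime_finrank_of_eq_two h2) π P hlift

/-- The four clause projections reassemble the crux (so `crux_of_facts` factors through them).
[folklore] -/
theorem crux_of_clauses (ha : baseChange_cyclic_cuspidal)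
    (hb : ArthurClozel1989_strongLifting_unramified) (hc : ArthurClozel1989_strongLifting_allFinite)
    (hd : ArthurClozel1989_strongLifting_archimedean) : QuadraticBaseChangeGL2 :=
  ⟨clauseA_of_cuspidal ha, clauseB_of_unramified hb, clauseC_of_allFinite hc,
    clauseD_of_archimedean hd⟩

/-- **The deciding theorem with QBC discharged by the named facts**: modulo the four printed
base-change theorems the route needs only its six other cruxes. [folklore] -/
theorem closes_of_facts (hQD : QuadraticDescentGL2) (ha : baseChange_cyclic_cuspidal)
    (hb : ArthurClozel1989_strongLifting_unramified) (hc : ArthurClozel1989_strongLifting_allFinite)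
    (hd : ArthurClozel1989_strongLifting_archimedean)
    (hE1 : ResidualBianchiDoorLevelBC) (hE2 : TwoAdicBianchiProModularityLevel)
    (hR : ArtinWeightRealisationEven) (hD : IcosahedralDescentLevelBC)
    (hJ : EvenArtinJunction) : _root_.Langlands :=
  closes hQD (crux_of_facts ha hb hc hd) hE1 hE2 hR hD hJ

end Summit.Langlands.Langlands.Cruxes.QuadraticBaseChangeGL2.StrategistR1

end
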